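/-
Copyright (c) 2026 the pub-hodgecm-mathlib formalisation cell (harness21).  Prover seat hodgecm-mathlib-K2Liu-p02 (g0),
Track B «K2-LIT» ∕ hLiu418 #184♮, unit U5 «DOUBLING ZETA» of the K2_Liu road, socket #16b `sig_K2LiuAdelicNormIntegrable`,
organ (IV-d) «Weil's adelic integrability», FILE (4) of steward K2Liu-p03 (g2)'s plan: THE FINITE-ADELIC COSET COUNT.  2026-09-03.
-/
import Literature.NumberTheory.Automorphic.GLnAdelicStructure
import Literature.NumberTheory.Automorphic.AdeleRingStrongApproximation
import Literature.NumberTheory.Automorphic.AdeleRingTopology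
import Summits.HodgeConjecture.HodgeConjecture.Theorems.K2LiuFiniteHeightCosetSeparation   -- ★ p855116 (K2Liu-p06): file (3), F-a ∕ F-b
import HarnessLib

/-!
# `#16b` file (4): the cosets of `GL_N(𝒪̂_K)` in `GL_N(𝔸_{K,f})` of bounded denominator are few —
# `#{y · GL_N(𝒪̂) : n·y, n·y⁻¹ integral} ≤ n^{2 [K:ℚ] N²}` (density of `𝓞_K` in `𝒪̂_K` + the separation lemma), and `Σ_{n ≤ T} n^k ≤ T^{k+1}`

Track B ∕ hLiu418 = stmt-HodgeConjecture-24832, line `K2_Liu_CurveThetaSigs`, unit U5, socket #16b `sig_K2LiuAdelicNormIntegrable`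
(`Cruxes/HLiu418/Lines/K2_Liu_CurveThetaSigs_U5_DoublingZeta.lean`): «for every Haar measure `ν` on `U(V)(𝔸)` and `β` large, `g ↦ ‖g‖^{-β}`
is `ν`-integrable».  Steward K2Liu-p03 (g2), plan `K2/K2Liu-p03/g2/PLAN-16b-AdelicNormIntegrable.v1.K2Liu-p03-g2.md` (fcf27cb5a8e040bd) §Files:
this is FILE (4) (F-c, F-d), dealt to K2Liu-p02 by LEAD F0P6-plan 2026-09-03T21:57:34Z ∕ split ruling 21:58:36Z (file (3) = K2Liu-p06).
The «smearing» route bounds the volume growth of the height ball of `GL_N(𝔸_{K,f})` by `μ_f(GL_N(𝒪̂)) · #cosets`; this file counts the cosets.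

* §1 (D) **DENSITY** `exists_integer_sub_eq_mul` — for `m ∈ 𝓞_K ∖ 0` and an integral finite adele `a ∈ 𝒪̂_K` there are `x ∈ 𝓞_K` and `z ∈ 𝒪̂_K`
  with `a − x = m · z` (`𝓞_K → 𝒪̂_K ∕ m 𝒪̂_K` is onto: strong approximation ★ `AdeleRing.strongApproximation_infinitePlace` at the adele
  `(0, a)` with the exponents `n_v = ord_v(m)`; the `k ∈ K` it produces is `v`-integral at every finite `v`, hence in `𝓞_K` by Mathlib
  `HeightOneSpectrum.mem_integers_of_valuation_le_one`).
* §2 (F-d) **SUM** `sum_pow_le_pow_succ` — `Σ_{n=1}^{T} n^k ≤ T^{k+1}`.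
* §3 (F-c) **COUNT** `exists_finset_cosets_of_natCast_mul_mem` — for `n ≥ 1` there is a finite set `F ⊆ GL_N(𝔸_{K,f})` with
  `|F| ≤ n^{2[K:ℚ]·N²}` such that every `y` with `n·y` and `n·y⁻¹` integral lies in `y₀ · GL_N(𝒪̂)` for some `y₀ ∈ F`: the class map
  `y ↦ (a_{ij} mod n²)_{ij} ∈ M_N(𝓞_K ∕ n²𝓞_K)` with `a_{ij} ∈ 𝓞_K`, `a_{ij} ≡ n·y_{ij} (mod n² 𝒪̂)` from §1 takes at most `|𝓞_K ∕ n²|^{N²} =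
  n^{2[K:ℚ]N²}` values (Mathlib `Ideal.absNorm_span_singleton`, `Algebra.norm_algebraMap`, `RingOfIntegers.rank`), and two `y`'s with the same
  value differ by an element of `GL_N(𝒪̂)` — the SEPARATION LEMMA of file (3) (★ `K2LiuFiniteHeightCosetSeparation.inv_mul_mem_glFiniteIntegralLevel_of_natCast`,
  K2Liu-p06).
* §4 **HEAD (frozen by the steward, memo v2 9f83d6a93367c6be)** `exists_finset_cover_finiteHeightBall` — `∃ C > 0, D, ∀ T ≥ 1, ∃ s, |s| ≤ C·T^D ∧
  {H_f ≤ T} ⊆ ⋃_{c ∈ s} c · GL_N(𝒪̂)` (`C = 1`, `D = 2[K:ℚ]N² + 1`; F-a of file (3) ★ `exists_nat_eq_finprod_localHeight_forall_mul_mem` + §2 + §3).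

[cite: WeilBNT1967, Ch. VII §3] [cite: BorelJacquet1979, §1.2] [cite: CasselsFrohlichANT1967, Ch. II §15 Theorem (strong approximation)]
No definition, no instance, no named fact; axioms ⊆ {propext, Classical.choice, Quot.sound}.
HONEST LABEL: HC_CM is proved only modulo the 7 printed citations (2 remaining named inputs: hLiu418 = stmt-HodgeConjecture-24832, h413 =
stmt-HodgeConjecture-24833) until rung 0 closes; this helper (`--supports stmt-HodgeConjecture-24832 --as helper`) moves no counter.
-/

noncomputable section

set_option autoImplicit false

open scoped MatrixGroups NNReal
open NumberField IsDedekindDomain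
open Literature.NumberTheory.Automorphic

namespace Summit.HodgeConjecture.HodgeConjecture.Cruxes.HLiu418.K2LiuFiniteHeightCosetCount

variable {K : Type} [Field K] [NumberField K]

/-! ## §1 (D) Density of `𝓞_K` in `𝒪̂_K`: `𝓞_K → 𝒪̂_K ∕ m 𝒪̂_K` is onto -/

/-- The `v`-adic valuation of `m ∈ 𝓞_K ∖ 0`, read on its finite adele, is `q_v^{−ord_v m}` with
`ord_v m = #{v in the factorisation of (m)}` (Mathlib `intValuation_if_neg`). [folklore] -/
theorem valued_algebraMap_finiteAdele_eq_exp_neg_count {m : 𝓞 K} (hm : m ≠ 0) (v : HeightOneSpectrum (𝓞 K)) :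
    Valued.v (algebraMap (𝓞 K) (FiniteAdeleRing (𝓞 K) K) m v) =
      WithZero.exp (-((Associates.mk v.asIdeal).count (Associates.mk (Ideal.span {m} : Ideal (𝓞 K))).factors : ℤ)) := by
  rw [IsScalarTower.algebraMap_apply (𝓞 K) K (FiniteAdeleRing (𝓞 K) K), valued_algebraMap_finiteAdele_apply,
    HeightOneSpectrum.valuation_of_algebraMap, HeightOneSpectrum.intValuation_if_neg _ hm]

/-- Only finitely many `v` have `ord_v m ≠ 0` (`m ≠ 0`; Mathlib `Ideal.finite_factors`, `Associates.count_ne_zero_iff_dvd`). [folklore] -/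
theorem finite_support_count {m : 𝓞 K} (hm : m ≠ 0) :
    (Function.support fun v : HeightOneSpectrum (𝓞 K) =>
      (Associates.mk v.asIdeal).count (Associates.mk (Ideal.span {m} : Ideal (𝓞 K))).factors).Finite := by
  have hI : (Ideal.span {m} : Ideal (𝓞 K)) ≠ 0 := by
    rw [Ne, Ideal.zero_eq_bot, Ideal.span_singleton_eq_bot]
    exact hm
  refine (Ideal.finite_factors hI).subset fun v hv => ?_
  exact (Associates.count_ne_zero_iff_dvd hI v.irreducible).1 hv

/-- **(D) DENSITY — `𝓞_K → 𝒪̂_K ∕ m·𝒪̂_K` is onto.**  For `m ∈ 𝓞_K ∖ 0` and an integral finite adele `a ∈ 𝒪̂_K` there are `x ∈ 𝓞_K` and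
`z ∈ 𝒪̂_K` with `a − x = m · z` in `𝔸_{K,f}`: strong approximation (★ `AdeleRing.strongApproximation_infinitePlace`, Cassels–Fröhlich II §15) at
the adele `(0, a)` with exponents `ord_v m` gives `k ∈ K` with `|a − k|_v ≤ |m|_v` for all finite `v`; then `|k|_v ≤ max(|a|_v, |a − k|_v) ≤ 1`
everywhere, so `k ∈ 𝓞_K` (Mathlib `mem_integers_of_valuation_le_one`), and `z := (a − k)∕m` is integral at every `v`.
[cite: CasselsFrohlichANT1967, Ch. II §15 Theorem (strong approximation)] -/
theorem exists_integer_sub_eq_mul {m : 𝓞 K} (hm : m ≠ 0) {a : FiniteAdeleRing (𝓞 K) K} (ha : a ∈ integralFiniteAdeles K) :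
    ∃ x : 𝓞 K, ∃ z ∈ integralFiniteAdeles K,
      a - algebraMap (𝓞 K) (FiniteAdeleRing (𝓞 K) K) x = algebraMap (𝓞 K) (FiniteAdeleRing (𝓞 K) K) m * z := by
  classical
  -- the exponents of `m` as a finitely supported function
  set nn : HeightOneSpectrum (𝓞 K) →₀ ℕ := Finsupp.ofSupportFinite _ (finite_support_count hm) with hnn
  have hnn_apply : ∀ v : HeightOneSpectrum (𝓞 K),
      nn v = (Associates.mk v.asIdeal).count (Associates.mk (Ideal.span {m} : Ideal (𝓞 K))).factors := fun v => by
    rw [hnn, Finsupp.ofSupportFinite_coe]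
  have hval : ∀ v : HeightOneSpectrum (𝓞 K),
      Valued.v (algebraMap (𝓞 K) (FiniteAdeleRing (𝓞 K) K) m v) = WithZero.exp (-(nn v : ℤ)) := fun v => by
    rw [hnn_apply, valued_algebraMap_finiteAdele_eq_exp_neg_count hm]
  -- strong approximation at the adele `(0, a)`
  obtain ⟨σ₀⟩ := (inferInstance : Nonempty (InfinitePlace K))
  obtain ⟨k, -, hk⟩ := AdeleRing.strongApproximation_infinitePlace K σ₀
    (((0 : InfiniteAdeleRing K), a) : AdeleRing (𝓞 K) K) nn one_pos
  have hk' : ∀ v : HeightOneSpectrum (𝓞 K),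
      Valued.v ((a - algebraMap K (FiniteAdeleRing (𝓞 K) K) k) v) ≤
        Valued.v (algebraMap (𝓞 K) (FiniteAdeleRing (𝓞 K) K) m v) := fun v => by
    rw [hval v]
    exact hk v
  -- `|m|_v ≤ 1` and `|a|_v ≤ 1`
  have hm1 : ∀ v : HeightOneSpectrum (𝓞 K), Valued.v (algebraMap (𝓞 K) (FiniteAdeleRing (𝓞 K) K) m v) ≤ 1 := fun v => by
    rw [IsScalarTower.algebraMap_apply (𝓞 K) K (FiniteAdeleRing (𝓞 K) K), valued_algebraMap_finiteAdele_apply,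
      HeightOneSpectrum.valuation_of_algebraMap]
    exact HeightOneSpectrum.intValuation_le_one v m
  have ha1 : ∀ v : HeightOneSpectrum (𝓞 K), Valued.v (a v) ≤ 1 := fun v => ha v
  -- `k` is integral at every finite place, hence `k ∈ 𝓞_K`
  have hkint : ∀ v : HeightOneSpectrum (𝓞 K), v.valuation K k ≤ 1 := fun v => by
    rw [← valued_algebraMap_finiteAdele_apply]
    have heq : algebraMap K (FiniteAdeleRing (𝓞 K) K) k v = a v - (a - algebraMap K (FiniteAdeleRing (𝓞 K) K) k) v := by
      rw [FiniteAdeleRing.sub_apply']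
      ring
    rw [heq]
    exact (Valuation.map_sub _ _ _).trans (max_le (ha1 v) ((hk' v).trans (hm1 v)))
  obtain ⟨x, hx⟩ := HeightOneSpectrum.mem_integers_of_valuation_le_one K k hkint
  have hxk : algebraMap (𝓞 K) (FiniteAdeleRing (𝓞 K) K) x = algebraMap K (FiniteAdeleRing (𝓞 K) K) k := by
    rw [IsScalarTower.algebraMap_apply (𝓞 K) K (FiniteAdeleRing (𝓞 K) K), hx]
  -- `m` is a unit of `𝔸_{K,f}` (it is a unit of the field `K`)
  have hmK : (algebraMap (𝓞 K) K m) ≠ 0 := fun h => hm ((map_eq_zero_iff _ (FaithfulSMul.algebraMap_injective (𝓞 K) K)).1 h)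
  have hmunit : IsUnit (algebraMap (𝓞 K) (FiniteAdeleRing (𝓞 K) K) m) := by
    rw [IsScalarTower.algebraMap_apply (𝓞 K) K (FiniteAdeleRing (𝓞 K) K)]
    exact (isUnit_iff_ne_zero.2 hmK).map _
  have hm0 : ∀ v : HeightOneSpectrum (𝓞 K), Valued.v (algebraMap (𝓞 K) (FiniteAdeleRing (𝓞 K) K) m v) ≠ 0 := fun v => by
    rw [hval v]
    exact WithZero.coe_ne_zero
  -- `z := m⁻¹ (a − x)`
  refine ⟨x, (↑(hmunit.unit⁻¹) : FiniteAdeleRing (𝓞 K) K) * (a - algebraMap (𝓞 K) (FiniteAdeleRing (𝓞 K) K) x), fun v => ?_, ?_⟩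
  · -- integrality of `z` at `v`: `|z|_v · |m|_v = |a − k|_v ≤ |m|_v`
    show Valued.v (((↑(hmunit.unit⁻¹) : FiniteAdeleRing (𝓞 K) K) * (a - algebraMap (𝓞 K) (FiniteAdeleRing (𝓞 K) K) x)) v) ≤ 1
    have hinv : (↑(hmunit.unit⁻¹) : FiniteAdeleRing (𝓞 K) K) v * algebraMap (𝓞 K) (FiniteAdeleRing (𝓞 K) K) m v = 1 := by
      rw [← FiniteAdeleRing.mul_apply', IsUnit.val_inv_mul]
      rfl
    have hzm : Valued.v (((↑(hmunit.unit⁻¹) : FiniteAdeleRing (𝓞 K) K) * (a - algebraMap (𝓞 K) (FiniteAdeleRing (𝓞 K) K) x)) v) *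
        Valued.v (algebraMap (𝓞 K) (FiniteAdeleRing (𝓞 K) K) m v) ≤
          1 * Valued.v (algebraMap (𝓞 K) (FiniteAdeleRing (𝓞 K) K) m v) := by
      rw [one_mul, ← map_mul, FiniteAdeleRing.mul_apply', mul_comm ((↑(hmunit.unit⁻¹) : FiniteAdeleRing (𝓞 K) K) v),
        mul_assoc, hinv, mul_one, hxk]
      exact hk' v
    exact le_of_mul_le_mul_right hzm (zero_lt_iff.2 (hm0 v))
  · rw [← mul_assoc, IsUnit.mul_val_inv, one_mul]

/-! ## §2 (F-d) The elementary sum -/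

/-- **(F-d)** `Σ_{n = 1}^{T} n^k ≤ T^{k+1}` (`T` terms, each `≤ T^k`). [folklore] -/
theorem sum_pow_le_pow_succ (k T : ℕ) : ∑ n ∈ Finset.Icc 1 T, (n : ℝ) ^ k ≤ (T : ℝ) ^ (k + 1) := by
  calc ∑ n ∈ Finset.Icc 1 T, (n : ℝ) ^ k ≤ ∑ _n ∈ Finset.Icc 1 T, (T : ℝ) ^ k := by
        refine Finset.sum_le_sum fun n hn => ?_
        have hnT : (n : ℝ) ≤ T := by exact_mod_cast (Finset.mem_Icc.1 hn).2
        exact pow_le_pow_left₀ (Nat.cast_nonneg n) hnT k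
    _ = (T : ℝ) ^ (k + 1) := by
        rw [Finset.sum_const, Nat.card_Icc, Nat.add_sub_cancel, nsmul_eq_mul, pow_succ, mul_comm]

/-! ## §3 (F-c) The coset count -/

/-- **`|𝓞_K ∕ n² 𝓞_K| = n^{2[K:ℚ]}`** (Mathlib `Ideal.absNorm_span_singleton`, `Algebra.norm_algebraMap`, `RingOfIntegers.rank`). [folklore] -/
theorem natCard_quotient_span_natCast_sq (n : ℕ) :
    Nat.card (𝓞 K ⧸ (Ideal.span {((n : 𝓞 K) ^ 2)} : Ideal (𝓞 K))) = n ^ (2 * Module.finrank ℚ K) := by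
  rw [← Submodule.cardQuot_apply, ← Ideal.absNorm_apply, Ideal.absNorm_span_singleton,
    show ((n : 𝓞 K) ^ 2) = algebraMap ℤ (𝓞 K) ((n : ℤ) ^ 2) by simp, Algebra.norm_algebraMap, RingOfIntegers.rank,
    ← pow_mul, Int.natAbs_pow, Int.natAbs_natCast]

/-- **(F-c) THE COSET COUNT.**  For `n ≥ 1` there is a finite `F ⊆ GL_N(𝔸_{K,f})`, `|F| ≤ n^{2[K:ℚ]N²}`, such that every `y ∈ GL_N(𝔸_{K,f})`
with `n·y` and `n·y⁻¹` integral lies in the coset `y₀ · GL_N(𝒪̂_K)` of some `y₀ ∈ F`.  PROOF: by §1 choose `a_{ij} ∈ 𝓞_K` with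
`a_{ij} ≡ n·y_{ij} (mod n²𝒪̂)`; the class `(a_{ij} mod n²)_{ij} ∈ M_N(𝓞_K ∕ n²)` takes `≤ |𝓞_K ∕ n²|^{N²} = n^{2[K:ℚ]N²}` values
(`natCard_quotient_span_natCast_sq`), and equal classes give `n·y′ − n·y ∈ n²·M_N(𝒪̂)`, whence `y⁻¹y′ ∈ GL_N(𝒪̂)` by the separation lemma of
file (3) ★ `inv_mul_mem_glFiniteIntegralLevel_of_natCast` (K2Liu-p06); `F` = one representative per attained class.
[cite: WeilBNT1967, Ch. VII §3] [cite: BorelJacquet1979, §1.2] -/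
theorem exists_finset_cosets_of_natCast_mul_mem (N : ℕ) {n : ℕ} (hn : n ≠ 0) :
    ∃ F : Finset (GL (Fin N) (FiniteAdeleRing (𝓞 K) K)),
      F.card ≤ n ^ (2 * Module.finrank ℚ K * (N * N)) ∧
      ∀ y : GL (Fin N) (FiniteAdeleRing (𝓞 K) K),
        (∀ i j, (n : FiniteAdeleRing (𝓞 K) K) * (y : Matrix (Fin N) (Fin N) (FiniteAdeleRing (𝓞 K) K)) i j ∈ integralFiniteAdeles K) →
        (∀ i j, (n : FiniteAdeleRing (𝓞 K) K) * ((y⁻¹ : GL (Fin N) (FiniteAdeleRing (𝓞 K) K)) :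
            Matrix (Fin N) (Fin N) (FiniteAdeleRing (𝓞 K) K)) i j ∈ integralFiniteAdeles K) →
          ∃ y₀ ∈ F, y₀⁻¹ * y ∈ glFiniteIntegralLevel N K := by
  classical
  -- the modulus `m = n²` and the finite ring `R = 𝓞_K ∕ n²`
  set m : 𝓞 K := (n : 𝓞 K) ^ 2 with hm_def
  have hm : m ≠ 0 := pow_ne_zero _ (Nat.cast_ne_zero.2 hn)
  set I : Ideal (𝓞 K) := Ideal.span {m} with hI_def
  have hI : I ≠ ⊥ := by
    rw [hI_def, Ne, Ideal.span_singleton_eq_bot]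
    exact hm
  haveI : Finite (𝓞 K ⧸ I) := Ideal.finiteQuotientOfFreeOfNeBot I hI
  letI : Fintype (𝓞 K ⧸ I) := Fintype.ofFinite _
  have hmcast : algebraMap (𝓞 K) (FiniteAdeleRing (𝓞 K) K) m = (n : FiniteAdeleRing (𝓞 K) K) ^ 2 := by
    rw [hm_def, map_pow, map_natCast]
  -- the admissible `y`'s and the integer approximants of `n·y`
  let P : GL (Fin N) (FiniteAdeleRing (𝓞 K) K) → Prop := fun y =>
    (∀ i j, (n : FiniteAdeleRing (𝓞 K) K) * (y : Matrix (Fin N) (Fin N) (FiniteAdeleRing (𝓞 K) K)) i j ∈ integralFiniteAdeles K) ∧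
    (∀ i j, (n : FiniteAdeleRing (𝓞 K) K) * ((y⁻¹ : GL (Fin N) (FiniteAdeleRing (𝓞 K) K)) :
        Matrix (Fin N) (Fin N) (FiniteAdeleRing (𝓞 K) K)) i j ∈ integralFiniteAdeles K)
  have happrox : ∀ y, P y → ∀ i j, ∃ x : 𝓞 K, ∃ z ∈ integralFiniteAdeles K,
      (n : FiniteAdeleRing (𝓞 K) K) * (y : Matrix (Fin N) (Fin N) (FiniteAdeleRing (𝓞 K) K)) i j -
        algebraMap (𝓞 K) (FiniteAdeleRing (𝓞 K) K) x = algebraMap (𝓞 K) (FiniteAdeleRing (𝓞 K) K) m * z :=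
    fun y hy i j => exists_integer_sub_eq_mul hm (hy.1 i j)
  -- the class map `Φ : y ↦ (a_{ij} mod n²)`
  let A : GL (Fin N) (FiniteAdeleRing (𝓞 K) K) → Fin N → Fin N → 𝓞 K := fun y i j =>
    if hy : P y then (happrox y hy i j).choose else 0
  have hA : ∀ y (hy : P y) i j, ∃ z ∈ integralFiniteAdeles K,
      (n : FiniteAdeleRing (𝓞 K) K) * (y : Matrix (Fin N) (Fin N) (FiniteAdeleRing (𝓞 K) K)) i j -
        algebraMap (𝓞 K) (FiniteAdeleRing (𝓞 K) K) (A y i j) = algebraMap (𝓞 K) (FiniteAdeleRing (𝓞 K) K) m * z := by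
    intro y hy i j
    simp only [A, dif_pos hy]
    exact (happrox y hy i j).choose_spec
  let Φ : GL (Fin N) (FiniteAdeleRing (𝓞 K) K) → Fin N → Fin N → 𝓞 K ⧸ I := fun y i j => Ideal.Quotient.mk I (A y i j)
  -- one representative per attained class
  let rep : (Fin N → Fin N → 𝓞 K ⧸ I) → GL (Fin N) (FiniteAdeleRing (𝓞 K) K) := fun c =>
    if h : ∃ y, P y ∧ Φ y = c then h.choose else 1
  refine ⟨Finset.univ.image rep, ?_, fun y hy₁ hy₂ => ?_⟩
  · -- `|F| ≤ |M_N(𝓞_K ∕ n²)| = n^{2[K:ℚ]N²}`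
    refine (Finset.card_image_le).trans ?_
    rw [Finset.card_univ, Fintype.card_fun, Fintype.card_fun, Fintype.card_fin, ← Nat.card_eq_fintype_card,
      natCard_quotient_span_natCast_sq, ← pow_mul, ← pow_mul]
  · -- `y ∈ rep(Φ y) · GL_N(𝒪̂)`
    have hy : P y := ⟨hy₁, hy₂⟩
    have hex : ∃ y', P y' ∧ Φ y' = Φ y := ⟨y, hy, rfl⟩
    set y₀ := rep (Φ y) with hy₀_def
    have hy₀ : P y₀ ∧ Φ y₀ = Φ y := by
      have h : rep (Φ y) = hex.choose := dif_pos hex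
      rw [hy₀_def, h]
      exact hex.choose_spec
    refine ⟨y₀, Finset.mem_image_of_mem rep (Finset.mem_univ _), ?_⟩
    refine K2LiuFiniteHeightCosetSeparation.inv_mul_mem_glFiniteIntegralLevel_of_natCast hn hy₀.1.2 hy.2 fun i j => ?_
    -- `n·y − n·y₀ = (n·y − a) − (n·y₀ − a₀) + (a − a₀)` with `a − a₀ ∈ n² 𝓞_K`
    obtain ⟨z, hz, hzy⟩ := hA y hy i j
    obtain ⟨z₀, hz₀, hzy₀⟩ := hA y₀ hy₀.1 i j
    have hcls : Ideal.Quotient.mk I (A y₀ i j) = Ideal.Quotient.mk I (A y i j) := by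
      have h := congrFun (congrFun hy₀.2 i) j
      exact h
    obtain ⟨b, hb⟩ := Ideal.mem_span_singleton'.1 (Ideal.Quotient.eq.1 hcls)
    -- hb : b * m = A y₀ i j - A y i j
    refine ⟨z - z₀ - algebraMap (𝓞 K) (FiniteAdeleRing (𝓞 K) K) b,
      sub_mem (sub_mem hz hz₀) (fun v => ?_), ?_⟩
    · rw [IsScalarTower.algebraMap_apply (𝓞 K) K (FiniteAdeleRing (𝓞 K) K), FiniteAdeleRing.algebraMap_apply]
      exact HeightOneSpectrum.coe_algebraMap_mem (𝓞 K) K v b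
    · rw [← hmcast]
      have hb' : algebraMap (𝓞 K) (FiniteAdeleRing (𝓞 K) K) (A y₀ i j) - algebraMap (𝓞 K) (FiniteAdeleRing (𝓞 K) K) (A y i j) =
          algebraMap (𝓞 K) (FiniteAdeleRing (𝓞 K) K) m * algebraMap (𝓞 K) (FiniteAdeleRing (𝓞 K) K) b := by
        rw [← map_sub, ← hb, map_mul, mul_comm]
      linear_combination hzy - hzy₀ - hb'


/-! ## §4 The frozen head: `{H_f ≤ T}` is covered by `≤ C·T^D` cosets of `GL_N(𝒪̂_K)` -/

/-- **FILE (4)'S HEAD (steward K2Liu-p03 (g2) memo v2 9f83d6a93367c6be, FROZEN; the statement file (6) consumes).**  For `N ≥ 1` there are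
`C > 0` and `D ∈ ℕ` such that for every `T ≥ 1` the finite-adelic height ball `{y ∈ GL_N(𝔸_{K,f}) : H_f(y) = ∏_v H_v(y) ≤ T}` is covered by the
cosets `c · GL_N(𝒪̂_K)` of a finite set `s` with `|s| ≤ C·T^D` (`C = 1`, `D = 2[K:ℚ]N² + 1`): by file (3)'s F-a ★
`exists_nat_eq_finprod_localHeight_forall_mul_mem` (K2Liu-p06) `H_f(y) = n ∈ ℕ` with `n·y`, `n·y⁻¹` integral, so `y` lies in one of the
`≤ n^{2[K:ℚ]N²}` cosets of §3; union over `n ≤ ⌊T⌋` and §2.  [cite: WeilBNT1967, Ch. VII §3] [cite: BorelJacquet1979, §1.2] -/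
theorem exists_finset_cover_finiteHeightBall (K : Type) [Field K] [NumberField K] (N : ℕ) [NeZero N] :
    ∃ (C : ℝ) (D : ℕ), 0 < C ∧ ∀ T : ℝ, 1 ≤ T →
      ∃ s : Finset (GL (Fin N) (FiniteAdeleRing (𝓞 K) K)),
        (s.card : ℝ) ≤ C * T ^ D ∧
        ∀ y : GL (Fin N) (FiniteAdeleRing (𝓞 K) K),
          ∏ᶠ v, (GLn.localHeight N K v (GLn.ofFinite N K y) : ℝ) ≤ T →
            ∃ c ∈ s, c⁻¹ * y ∈ glFiniteIntegralLevel N K := by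
  classical
  set E : ℕ := 2 * Module.finrank ℚ K * (N * N) with hE
  -- the finsets of §3, one for each `n ≥ 1`
  have hF : ∀ n : ℕ, ∃ F : Finset (GL (Fin N) (FiniteAdeleRing (𝓞 K) K)), n ≠ 0 →
      F.card ≤ n ^ E ∧
      ∀ y : GL (Fin N) (FiniteAdeleRing (𝓞 K) K),
        (∀ i j, (n : FiniteAdeleRing (𝓞 K) K) * (y : Matrix (Fin N) (Fin N) (FiniteAdeleRing (𝓞 K) K)) i j ∈ integralFiniteAdeles K) →
        (∀ i j, (n : FiniteAdeleRing (𝓞 K) K) * ((y⁻¹ : GL (Fin N) (FiniteAdeleRing (𝓞 K) K)) :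
            Matrix (Fin N) (Fin N) (FiniteAdeleRing (𝓞 K) K)) i j ∈ integralFiniteAdeles K) →
          ∃ y₀ ∈ F, y₀⁻¹ * y ∈ glFiniteIntegralLevel N K := by
    intro n
    by_cases hn : n = 0
    · exact ⟨∅, fun h => (h hn).elim⟩
    · obtain ⟨F, hF⟩ := exists_finset_cosets_of_natCast_mul_mem (K := K) N hn
      exact ⟨F, fun _ => hF⟩
  choose F hF using hF
  refine ⟨1, E + 1, one_pos, fun T hT => ?_⟩
  have hT0 : 0 ≤ T := zero_le_one.trans hT
  refine ⟨(Finset.Icc 1 ⌊T⌋₊).biUnion F, ?_, fun y hy => ?_⟩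
  · -- `|s| ≤ Σ_{n ≤ ⌊T⌋} n^E ≤ ⌊T⌋^{E+1} ≤ T^{E+1}`
    calc (((Finset.Icc 1 ⌊T⌋₊).biUnion F).card : ℝ) ≤ ((∑ n ∈ Finset.Icc 1 ⌊T⌋₊, (F n).card : ℕ) : ℝ) := by
          exact_mod_cast Finset.card_biUnion_le
      _ = ∑ n ∈ Finset.Icc 1 ⌊T⌋₊, ((F n).card : ℝ) := by push_cast; rfl
      _ ≤ ∑ n ∈ Finset.Icc 1 ⌊T⌋₊, (n : ℝ) ^ E := by
          refine Finset.sum_le_sum fun n hn => ?_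
          have hn1 : n ≠ 0 := Nat.one_le_iff_ne_zero.1 (Finset.mem_Icc.1 hn).1
          exact_mod_cast (hF n hn1).1
      _ ≤ (⌊T⌋₊ : ℝ) ^ (E + 1) := sum_pow_le_pow_succ E ⌊T⌋₊
      _ ≤ T ^ (E + 1) := pow_le_pow_left₀ (Nat.cast_nonneg _) (Nat.floor_le hT0) _
      _ = 1 * T ^ (E + 1) := (one_mul _).symm
  · -- `H_f(y) = n ≤ T`, `n·y`, `n·y⁻¹` integral (file (3), F-a), and `y ∈ y₀ · GL_N(𝒪̂)` for some `y₀ ∈ F n ⊆ s`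
    obtain ⟨n, hn0, hnH, hny, hny'⟩ := K2LiuFiniteHeightCosetSeparation.exists_nat_eq_finprod_localHeight_forall_mul_mem y
    have hnT : n ≤ ⌊T⌋₊ := Nat.le_floor (hnH ▸ hy)
    obtain ⟨y₀, hy₀F, hy₀⟩ := (hF n hn0.ne').2 y hny hny'
    exact ⟨y₀, Finset.mem_biUnion.2 ⟨n, Finset.mem_Icc.2 ⟨hn0, hnT⟩, hy₀F⟩, hy₀⟩

end Summit.HodgeConjecture.HodgeConjecture.Cruxes.HLiu418.K2LiuFiniteHeightCosetCount

end
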